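import Mathlib.Analysis.SpecialFunctions.Exp
import Mathlib.Analysis.SpecialFunctions.SmoothTransition
import Mathlib.Analysis.Calculus.Deriv.Inv
import HarnessLib

/-!
# The algebra of the elliptic Hamilton–Ivey estimate on a three-dimensional shrinker

Pure real-analysis lemmas behind the elliptic form of the Hamilton–Ivey pinching estimate
(Hamilton 1995, §24, Thm. 24.4) on a three-dimensional gradient shrinking Ricci soliton. With
Ricci eigenvalues `a, b ≤ c`, scalar curvature `S = a + b + c`, `X = c − a − b` (`= −2 ·` the
smallest sectional curvature) and the Hamilton–Ivey quantity `Ω(X, R) = X · exp (−R/X)`, the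
reaction terms of `Δ_f Ric(e, e)` (top eigenvector `e`) and of `Δ_f S` are
`T_c = c − (a(a + c − b) + b(b + c − a))` and `T_S = S − 2|Ric|² = S − 2(a² + b² + c²)`; at a
maximum point of (a cut-off of) `Ω(X, S)` one needs

  `Ω (1 + X) ≤ 2α T_c + κ T_S`,  `α = ∂Ω/∂X = e^{−S/X}(1 + S/X)`,  `κ = −α − e^{−S/X}`,

which is `key_ineq`; multiplied by `X e^{S/X} > 0` it is the cubic inequality `cubic_nonneg`

  `0 ≤ 2(X + S) T_c − (2X + S) T_S − X²(1 + X)`   (`a, b ≤ c`, `X > 0`).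

In the variables `t = c − max(a, b) ≥ 0`, `p = |a − b| ≥ 0` its right-hand side is
`16t³ + 8p²t + 24pt² − 12Xt² − 12Xpt + X³ = 8t p² + 12t(2t − X) p + (X − 2t)²(X + 4t)`
`= 8t (p + 3t/2 − 3X/4)² + (2t − X)²(X − t/2)`, non-negative in the two cases `2X ≤ t`, `t ≤ 2X`
(all terms of degree two cancel identically; the polynomial is symmetric in `a, b`).

The remaining five lemmas are the elementary convexity/monotonicity/continuity facts of `Ω` used
by the maximum-principle argument:

* `tangent_le` — the tangent plane of `Ω` at `(X₀, R₀)`, `X₀ > 0`, lies below the graph on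
  `X > 0` (after division by `e^{−R₀/X₀}` it is `1 + q ≤ e^q` with `q = R₀/X₀ − R/X`: the
  difference is `e^{−R₀/X₀} · X · (e^q − 1 − q)`);
* `tangent_nonpos` — that tangent plane is `≤ 0` where `X ≤ 0 ≤ R` (`R₀ ≥ 0`);
* `mul_exp_mono` — `t ↦ t e^{−R/t}` is monotone on `t > 0` for `R ≥ 0` (both factors are
  monotone and non-negative; no calculus);
* `mul_exp_le_self` — `X e^{−R/X} ≤ X` for `R, X ≥ 0` (`e^{−R/X} ≤ 1`; Lean's `R/0 = 0` is
  harmless);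
* `continuous_posPart_mul_exp` — for continuous `X` and `R ≥ 0` on a topological space, the
  positive part `a ↦ Ω⁺(X a, R a)` (`Ω⁺ = Ω` on `X > 0`, `0` on `X ≤ 0`) is continuous (at `X = 0`
  it is squeezed between `0` and `max X 0`), so that a cut-off of it attains its maximum on a
  compact set.

The last two lemmas are the one-variable analysis behind step 1 of Munteanu–Wang's theorem that
positively curved shrinkers are compact (Munteanu–Wang 2017, Thm. 2, here `n = 3`): the minimum
principle is applied to `λ_min(Ric) − a · gb(f)` with the barrier `gb(t) = 1/t + 3/t²`, and at the
minimum point one needs `Δ_f (gb ∘ f) ≥ gb(f)`, where on a normalised shrinker (`Δ_f f = 3/2 − f`,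
`|∇f|² = f − S`, `0 ≤ S ≤ f`) `Δ_f (gb ∘ f) = gb'(f) (3/2 − f) + gb''(f) (f − S)`:

* `barrier_ineq` — `gb(t) ≤ gb'(t) (3/2 − t) + gb''(t) (t − S)` for `t ≥ 6` and `0 ≤ S ≤ t`
  (multiplied by `t⁴`, the difference of the two sides is `7t²/2 + 9t − S(2t + 18) ≥ t(3t/2 − 9)`);
* `exists_smooth_barrier` — a globally `C²` function `gb : ℝ → ℝ` with `gb t = 1/t + 3/t²`,
  `gb' t = −1/t² − 6/t³` and `gb'' t = 2/t³ + 18/t⁴` for `t ≥ 2` (the chart-level chain rule for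
  `Δ_f (gb ∘ f)` wants a function on all of `ℝ`): `gb = 1/θ + 3/θ²` for the smooth
  reparametrisation `θ(t) = 1 + (t − 1) · smoothTransition (2(t − 1)) ≥ 1` of the line, which is
  the identity on `[3/2, ∞)`; `exists_smooth_barrier'` is the `C^∞` version of the same statement
  (same witness), for consumers working in the smooth category.

Everything is proved; no definitions, no named facts.

## References

* R. S. Hamilton, *The formation of singularities in the Ricci flow*, Surveys in Differential
  Geometry II (1995) 7–136, §24, Thm. 24.4 (the Hamilton–Ivey pinching computation).
  [Hamilton1995]
* O. Munteanu, J. Wang, *Positively curved shrinking Ricci solitons are compact*, J. Differential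
  Geom. 106 (2017) 499–505, Thm. 2, step 1 of the proof (the barrier `a(f⁻¹ + n f⁻²)`).
  [MunteanuWang2017]
-/

namespace Literature.Geometry.Riemannian.HamiltonIvey

/-- The Hamilton–Ivey cubic in the variables `t = c − b ≥ 0`, `p = b − a ≥ 0`, `X = c − a − b > 0`
(case `a ≤ b`): `0 ≤ 16t³ + 8p²t + 24pt² − 12Xt² − 12Xpt + X³`. For `t ≤ 2X` the right-hand
side equals `8t(p + 3t/2 − 3X/4)² + (2t − X)²(X − t/2)`, for `2X ≤ t` it equals
`8tp² + 12t(2t − X)p + (X − 2t)²(X + 4t)`; in either case every term is non-negative.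
[cite: Hamilton1995, §24, Thm. 24.4] -/
private theorem cubic_nonneg_aux (t p X : ℝ) (ht : 0 ≤ t) (hp : 0 ≤ p) (hX : 0 < X) :
    0 ≤ 16 * t ^ 3 + 8 * p ^ 2 * t + 24 * p * t ^ 2 - 12 * X * t ^ 2 - 12 * X * p * t
      + X ^ 3 := by
  rcases le_total t (2 * X) with h | h
  · have e : 16 * t ^ 3 + 8 * p ^ 2 * t + 24 * p * t ^ 2 - 12 * X * t ^ 2 - 12 * X * p * t
        + X ^ 3 = 8 * t * (p + 3 / 2 * t - 3 / 4 * X) ^ 2 + (2 * t - X) ^ 2 * (X - t / 2) := by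
      ring
    rw [e]
    have h' : 0 ≤ X - t / 2 := by linarith
    exact add_nonneg (mul_nonneg (by positivity) (sq_nonneg _)) (mul_nonneg (sq_nonneg _) h')
  · have e : 16 * t ^ 3 + 8 * p ^ 2 * t + 24 * p * t ^ 2 - 12 * X * t ^ 2 - 12 * X * p * t
        + X ^ 3 = 8 * t * p ^ 2 + 12 * t * (2 * t - X) * p + (X - 2 * t) ^ 2 * (X + 4 * t) := by
      ring
    rw [e]
    have h' : 0 ≤ 2 * t - X := by linarith
    exact add_nonneg (add_nonneg (by positivity) (mul_nonneg (mul_nonneg (by positivity) h') hp))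
      (mul_nonneg (sq_nonneg _) (by positivity))

/-- **The cubic inequality of the elliptic Hamilton–Ivey estimate.** For real `a, b ≤ c` with
`X = c − a − b > 0` and `S = a + b + c`,
`0 ≤ 2(X + S)·(c − (a(a + c − b) + b(b + c − a))) − (2X + S)·(S − 2(a² + b² + c²)) − X²(1 + X)`.
The right-hand side expands to `2abc + ab² − 3ac² + a²b − a²c − a³ − 3bc² − b²c − b³ + 5c³`
(symmetric in `a, b`) and, with `t = c − max(a,b)`, `p = |a − b|`, to
`16t³ + 8p²t + 24pt² − 12Xt² − 12Xpt + X³ ≥ 0` (`cubic_nonneg_aux`). This is the algebra of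
Hamilton's pinching computation for the Hamilton–Ivey quantity `X e^{−S/X}` at a maximum point.
[cite: Hamilton1995, §24, Thm. 24.4] -/
theorem cubic_nonneg (a b c : ℝ) (hac : a ≤ c) (hbc : b ≤ c) (hX : 0 < c - a - b) :
    0 ≤ 2 * ((c - a - b) + (a + b + c)) * (c - (a * (a + c - b) + b * (b + c - a)))
      - (2 * (c - a - b) + (a + b + c)) * ((a + b + c) - 2 * (a ^ 2 + b ^ 2 + c ^ 2))
      - (c - a - b) ^ 2 * (1 + (c - a - b)) := by
  rcases le_total a b with hab | hab
  · have key :=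
      cubic_nonneg_aux (c - b) (b - a) (c - a - b) (sub_nonneg.2 hbc) (sub_nonneg.2 hab) hX
    exact key.trans_eq (by ring)
  · have key :=
      cubic_nonneg_aux (c - a) (a - b) (c - a - b) (sub_nonneg.2 hac) (sub_nonneg.2 hab) hX
    exact key.trans_eq (by ring)

/-- The rational identity behind `key_ineq`: with `q, X ≠ 0, S, T_c, T_S` free,
`2q(1 + S/X) T_c + (−q(1 + S/X) − q) T_S − X q (1 + X)
  = (q/X) · (2(X + S) T_c − (2X + S) T_S − X²(1 + X))`. [folklore] -/
private theorem key_identity (q X S Tc TS : ℝ) (hX : X ≠ 0) :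
    2 * (q * (1 + S / X)) * Tc + (-(q * (1 + S / X)) - q) * TS - X * q * (1 + X)
      = q / X * (2 * (X + S) * Tc - (2 * X + S) * TS - X ^ 2 * (1 + X)) := by
  field_simp
  ring

/-- **The elliptic Hamilton–Ivey inequality at a maximum point** (eigenvalue form). For real
`a, b ≤ c` with `X = c − a − b > 0`, `S = a + b + c`, `q = e^{−S/X}`, `α = q(1 + S/X)` (the
`X`-derivative of `Ω(X, R) = X e^{−R/X}` at `R = S`) and `κ = −α − q`,
`Ω (1 + X) = X q (1 + X) ≤ 2α · (c − (a(a + c − b) + b(b + c − a))) + κ · (S − 2(a² + b² + c²))`.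
It is `cubic_nonneg` multiplied by `q / X > 0` (`key_identity`).
[cite: Hamilton1995, §24, Thm. 24.4] -/
theorem key_ineq (a b c : ℝ) (hac : a ≤ c) (hbc : b ≤ c) (hX : 0 < c - a - b) :
    (c - a - b) * Real.exp (-(a + b + c) / (c - a - b)) * (1 + (c - a - b)) ≤
      2 * (Real.exp (-(a + b + c) / (c - a - b)) * (1 + (a + b + c) / (c - a - b)))
          * (c - (a * (a + c - b) + b * (b + c - a)))
        + (-(Real.exp (-(a + b + c) / (c - a - b)) * (1 + (a + b + c) / (c - a - b)))
            - Real.exp (-(a + b + c) / (c - a - b)))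
          * ((a + b + c) - 2 * (a ^ 2 + b ^ 2 + c ^ 2)) := by
  have hP := cubic_nonneg a b c hac hbc hX
  have e := key_identity (Real.exp (-(a + b + c) / (c - a - b))) (c - a - b) (a + b + c)
    (c - (a * (a + c - b) + b * (b + c - a))) ((a + b + c) - 2 * (a ^ 2 + b ^ 2 + c ^ 2)) hX.ne'
  have h0 : 0 ≤ Real.exp (-(a + b + c) / (c - a - b)) / (c - a - b)
      * (2 * ((c - a - b) + (a + b + c)) * (c - (a * (a + c - b) + b * (b + c - a)))
        - (2 * (c - a - b) + (a + b + c)) * ((a + b + c) - 2 * (a ^ 2 + b ^ 2 + c ^ 2))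
        - (c - a - b) ^ 2 * (1 + (c - a - b))) :=
    mul_nonneg (div_nonneg (Real.exp_pos _).le hX.le) hP
  linarith

/-- The rational identity behind `tangent_le`: with `E₀, e` free and `X₀, X ≠ 0`,
`X (E₀ e) − (X₀ E₀ + E₀ (1 + R₀/X₀)(X − X₀) − E₀ (R − R₀)) = E₀ X (e − (R₀/X₀ − R/X + 1))`.
[folklore] -/
private theorem tangent_identity (X₀ R₀ X R E₀ e : ℝ) (hX₀ : X₀ ≠ 0) (hX : X ≠ 0) :
    X * (E₀ * e) - (X₀ * E₀ + E₀ * (1 + R₀ / X₀) * (X - X₀) - E₀ * (R - R₀))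
      = E₀ * X * (e - (R₀ / X₀ - R / X + 1)) := by
  field_simp
  ring

/-- **The tangent plane of `Ω(X, R) = X e^{−R/X}` lies below its graph** (`Ω` is convex on
`X > 0`): for `X₀, X > 0` and all `R₀, R`,
`Ω(X₀, R₀) + ∂_X Ω(X₀, R₀) (X − X₀) + ∂_R Ω(X₀, R₀) (R − R₀) ≤ Ω(X, R)`, where
`∂_X Ω = e^{−R/X}(1 + R/X)` and `∂_R Ω = −e^{−R/X}`. Proof: the difference is
`e^{−R₀/X₀} X (e^q − 1 − q) ≥ 0`, `q = R₀/X₀ − R/X`. [folklore] -/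
theorem tangent_le (X₀ R₀ X R : ℝ) (hX₀ : 0 < X₀) (hX : 0 < X) :
    X₀ * Real.exp (-R₀ / X₀) + Real.exp (-R₀ / X₀) * (1 + R₀ / X₀) * (X - X₀)
        - Real.exp (-R₀ / X₀) * (R - R₀) ≤ X * Real.exp (-R / X) := by
  have hexp : Real.exp (-R / X) = Real.exp (-R₀ / X₀) * Real.exp (R₀ / X₀ - R / X) := by
    rw [← Real.exp_add]
    congr 1
    ring
  have e := tangent_identity X₀ R₀ X R (Real.exp (-R₀ / X₀)) (Real.exp (R₀ / X₀ - R / X))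
    hX₀.ne' hX.ne'
  have h0 : 0 ≤ Real.exp (-R₀ / X₀) * X
      * (Real.exp (R₀ / X₀ - R / X) - (R₀ / X₀ - R / X + 1)) :=
    mul_nonneg (mul_nonneg (Real.exp_pos _).le hX.le) (sub_nonneg.2 (Real.add_one_le_exp _))
  rw [hexp]
  linarith

/-- The rational identity behind `tangent_nonpos`: with `E₀` free and `X₀ ≠ 0`,
`X₀ E₀ + E₀ (1 + R₀/X₀)(X − X₀) − E₀ (R − R₀) = E₀ (X (1 + R₀/X₀) − R)`. [folklore] -/
private theorem tangent_identity' (X₀ R₀ X R E₀ : ℝ) (hX₀ : X₀ ≠ 0) :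
    X₀ * E₀ + E₀ * (1 + R₀ / X₀) * (X - X₀) - E₀ * (R - R₀) = E₀ * (X * (1 + R₀ / X₀) - R) := by
  field_simp
  ring

/-- **The tangent plane of `Ω` is non-positive on `X ≤ 0 ≤ R`.** For `X₀ > 0`, `R₀ ≥ 0`,
`X ≤ 0` and `R ≥ 0`, `Ω(X₀, R₀) + ∂_X Ω(X₀, R₀)(X − X₀) + ∂_R Ω(X₀, R₀)(R − R₀) ≤ 0`; indeed the
left-hand side is `e^{−R₀/X₀}(X(1 + R₀/X₀) − R)`. [folklore] -/
theorem tangent_nonpos (X₀ R₀ X R : ℝ) (hX₀ : 0 < X₀) (hR₀ : 0 ≤ R₀) (hX : X ≤ 0) (hR : 0 ≤ R) :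
    X₀ * Real.exp (-R₀ / X₀) + Real.exp (-R₀ / X₀) * (1 + R₀ / X₀) * (X - X₀)
        - Real.exp (-R₀ / X₀) * (R - R₀) ≤ 0 := by
  rw [tangent_identity' X₀ R₀ X R _ hX₀.ne']
  have h1 : X * (1 + R₀ / X₀) ≤ 0 := mul_nonpos_of_nonpos_of_nonneg hX (by positivity)
  exact mul_nonpos_of_nonneg_of_nonpos (Real.exp_pos _).le (by linarith)

/-- **Monotonicity of `t ↦ t e^{−R/t}` on `t > 0`** for `R ≥ 0`: if `0 < X₁ ≤ X₂` then
`X₁ e^{−R/X₁} ≤ X₂ e^{−R/X₂}` (both factors are non-negative and monotone). [folklore] -/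
theorem mul_exp_mono (R X₁ X₂ : ℝ) (hR : 0 ≤ R) (hX₁ : 0 < X₁) (h : X₁ ≤ X₂) :
    X₁ * Real.exp (-R / X₁) ≤ X₂ * Real.exp (-R / X₂) := by
  have h1 : R / X₂ ≤ R / X₁ := div_le_div_of_nonneg_left hR hX₁ h
  have h2 : Real.exp (-R / X₁) ≤ Real.exp (-R / X₂) := by
    rw [Real.exp_le_exp, neg_div, neg_div]
    exact neg_le_neg h1
  exact mul_le_mul h h2 (Real.exp_pos _).le (hX₁.le.trans h)

/-- **`X e^{−R/X} ≤ X`** for `R, X ≥ 0` (`e^{−R/X} ≤ 1`; with Lean's convention `R/0 = 0` the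
case `X = 0` reads `0 ≤ 0`). [folklore] -/
theorem mul_exp_le_self (R X : ℝ) (hR : 0 ≤ R) (hX : 0 ≤ X) : X * Real.exp (-R / X) ≤ X := by
  refine mul_le_of_le_one_right hX (Real.exp_le_one_iff.2 ?_)
  rw [neg_div]
  exact neg_nonpos.2 (div_nonneg hR hX)

open Filter Topology in
/-- **Continuity of the positive part of the Hamilton–Ivey quantity.** For continuous real
functions `X` and `R ≥ 0` on a topological space, the function `a ↦ Ω⁺(X a, R a)`, where
`Ω⁺(X, R) = X e^{−R/X}` for `X > 0` and `Ω⁺(X, R) = 0` for `X ≤ 0`, is continuous: on the open set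
`{X > 0}` it is the smooth branch, on the open set `{X < 0}` it is locally `0`, and at a point with
`X = 0` (where its value is `0`) it is squeezed between `0` and `max X 0 → 0` (`mul_exp_le_self`).
The sign condition on `R` is needed: for `R < 0`, `X e^{|R|/X} → ∞` as `X → 0⁺`. [folklore] -/
theorem continuous_posPart_mul_exp {α : Type*} [TopologicalSpace α] {X R : α → ℝ}
    (hX : Continuous X) (hR : Continuous R) (hR0 : ∀ a, 0 ≤ R a) :
    Continuous fun a ↦ if 0 < X a then X a * Real.exp (-R a / X a) else 0 := by
  refine continuous_iff_continuousAt.2 fun a₀ ↦ ?_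
  rcases lt_trichotomy 0 (X a₀) with h0 | h0 | h0
  · -- `0 < X a₀`: eventually the branch `X e^{−R/X}`, continuous at `a₀` since `X a₀ ≠ 0`
    have hc : ContinuousAt (fun a ↦ X a * Real.exp (-R a / X a)) a₀ :=
      hX.continuousAt.mul (Real.continuous_exp.continuousAt.comp
        (hR.neg.continuousAt.div hX.continuousAt h0.ne'))
    refine hc.congr ?_
    filter_upwards [hX.continuousAt.eventually (lt_mem_nhds h0)] with a ha
    exact (if_pos ha).symm
  · -- `X a₀ = 0`: the value is `0`; squeeze between `0` and `max X 0`
    show Tendsto _ _ (𝓝 (if 0 < X a₀ then X a₀ * Real.exp (-R a₀ / X a₀) else 0))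
    rw [if_neg (not_lt.2 h0.ge)]
    have h1 : Tendsto (fun a ↦ max (X a) 0) (𝓝 a₀) (𝓝 (max (X a₀) 0)) :=
      (hX.max continuous_const).tendsto a₀
    rw [← h0, max_self] at h1
    refine tendsto_of_tendsto_of_tendsto_of_le_of_le tendsto_const_nhds h1 (fun a ↦ ?_)
      (fun a ↦ ?_)
    · dsimp only
      split_ifs with h
      · exact mul_nonneg h.le (Real.exp_pos _).le
      · exact le_rfl
    · dsimp only
      split_ifs with h
      · exact (mul_exp_le_self (R a) (X a) (hR0 a) h.le).trans (le_max_left _ _)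
      · exact le_max_right _ _
  · -- `X a₀ < 0`: eventually the constant `0`
    refine (continuousAt_const (y := (0 : ℝ))).congr ?_
    filter_upwards [hX.continuousAt.eventually (gt_mem_nhds h0)] with a ha
    exact (if_neg (not_lt.2 ha.le)).symm

/-- **The Munteanu–Wang barrier inequality** (step 1 of the proof that positively curved
shrinkers are compact, `n = 3`). For the barrier `gb(t) = 1/t + 3/t²` one has
`gb'(t) = −1/t² − 6/t³`, `gb''(t) = 2/t³ + 18/t⁴`, and for `t ≥ 6`, `0 ≤ S ≤ t`,
`gb(t) ≤ gb'(t) · (3/2 − t) + gb''(t) · (t − S)`; on a normalised three-dimensional shrinker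
(`Δ_f f = 3/2 − f`, `|∇f|² = f − S`) the right-hand side is `Δ_f (gb ∘ f)` at a point with `f = t`
and scalar curvature `S`. Proof: multiplied by `t⁴ > 0` the difference of the two sides is
`7t²/2 + 9t − S(2t + 18) ≥ 7t²/2 + 9t − t(2t + 18) = t(3t/2 − 9) ≥ 0` (only `S ≤ t` and `t ≥ 6`
are used; the sign hypothesis on `S` is part of the geometric setting).
[cite: MunteanuWang2017, Thm. 2] -/
theorem barrier_ineq (t S : ℝ) (ht : 6 ≤ t) (hS0 : 0 ≤ S) (hSt : S ≤ t) :
    1 / t + 3 / t ^ 2 ≤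
      (-1 / t ^ 2 - 6 / t ^ 3) * (3 / 2 - t) + (2 / t ^ 3 + 18 / t ^ 4) * (t - S) := by
  have _ := hS0 -- not needed for the inequality
  have ht0 : 0 < t := by linarith
  rw [← sub_nonneg]
  have e : (-1 / t ^ 2 - 6 / t ^ 3) * (3 / 2 - t) + (2 / t ^ 3 + 18 / t ^ 4) * (t - S)
      - (1 / t + 3 / t ^ 2) = (7 / 2 * t ^ 2 + 9 * t - S * (2 * t + 18)) / t ^ 4 := by
    field_simp
    ring
  rw [e]
  refine div_nonneg ?_ (by positivity)
  nlinarith [mul_le_mul_of_nonneg_right hSt (by linarith : (0 : ℝ) ≤ 2 * t + 18),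
    mul_nonneg ht0.le (by linarith : (0 : ℝ) ≤ 3 / 2 * t - 9)]

open Filter Topology in
/-- **A globally `C²` extension of the Munteanu–Wang barrier `1/t + 3/t²`.** There is a `C²`
function `gb : ℝ → ℝ` with `gb t = 1/t + 3/t²`, `gb' t = −1/t² − 6/t³` and
`gb'' t = 2/t³ + 18/t⁴` for all `t ≥ 2` (this is the form in which the chain rule for
`Δ_f (gb ∘ f)` in a chart consumes the barrier of step 1 of Munteanu–Wang 2017, Thm. 2).
Construction: `gb = 1/θ + 3/θ²` with `θ(t) = 1 + (t − 1) · smoothTransition (2(t − 1))`, a smooth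
function with `θ ≥ 1` (so `gb` is smooth on all of `ℝ`) and `θ(t) = t` for `t ≥ 3/2`; hence `gb`
agrees with `1/t + 3/t²` on the open set `(3/2, ∞) ⊇ [2, ∞)`, where the two derivatives are computed
from `(1/t)' = −1/t²`, `(3/t²)' = −6/t³`, `(−1/t²)' = 2/t³`, `(−6/t³)' = 18/t⁴`. [folklore] -/
theorem exists_smooth_barrier : ∃ gb : ℝ → ℝ, ContDiff ℝ 2 gb ∧
    (∀ t, 2 ≤ t → gb t = 1 / t + 3 / t ^ 2) ∧
    (∀ t, 2 ≤ t → deriv gb t = -1 / t ^ 2 - 6 / t ^ 3) ∧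
    (∀ t, 2 ≤ t → deriv (deriv gb) t = 2 / t ^ 3 + 18 / t ^ 4) := by
  -- a smooth reparametrisation `θ ≥ 1` of the line with `θ t = t` for `t ≥ 3/2`
  set θ : ℝ → ℝ := fun t ↦ 1 + (t - 1) * Real.smoothTransition (2 * (t - 1))
  have hθ : ContDiff ℝ 2 θ :=
    contDiff_const.add ((contDiff_id.sub contDiff_const).mul
      (Real.smoothTransition.contDiff.comp (contDiff_const.mul (contDiff_id.sub contDiff_const))))
  have hθ1 : ∀ t, 1 ≤ θ t := by
    intro t
    rcases le_total t 1 with h | h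
    · have h0 : Real.smoothTransition (2 * (t - 1)) = 0 :=
        Real.smoothTransition.zero_of_nonpos (by linarith)
      simp only [θ, h0, mul_zero, add_zero, le_refl]
    · have h0 : 0 ≤ (t - 1) * Real.smoothTransition (2 * (t - 1)) :=
        mul_nonneg (sub_nonneg.2 h) (Real.smoothTransition.nonneg _)
      show 1 ≤ 1 + (t - 1) * Real.smoothTransition (2 * (t - 1))
      linarith
  have hθne : ∀ t, θ t ≠ 0 := fun t ↦ (zero_lt_one.trans_le (hθ1 t)).ne'
  have hθid : ∀ t, 3 / 2 < t → θ t = t := by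
    intro t ht
    have h1 : Real.smoothTransition (2 * (t - 1)) = 1 :=
      Real.smoothTransition.one_of_one_le (by linarith)
    show 1 + (t - 1) * Real.smoothTransition (2 * (t - 1)) = t
    rw [h1]
    ring
  -- the explicit branch `1/t + 3/t²` and its first two derivatives on `t ≠ 0`
  have hg1 : ∀ t : ℝ, t ≠ 0 →
      HasDerivAt (fun t : ℝ ↦ 1 / t + 3 / t ^ 2) (-1 / t ^ 2 - 6 / t ^ 3) t := by
    intro t ht
    have h := ((hasDerivAt_const t (1 : ℝ)).fun_div (hasDerivAt_id' t) ht).fun_add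
      ((hasDerivAt_const t (3 : ℝ)).fun_div (hasDerivAt_pow 2 t) (pow_ne_zero 2 ht))
    refine h.congr_deriv ?_
    field_simp
    ring
  have hg2 : ∀ t : ℝ, t ≠ 0 →
      HasDerivAt (fun t : ℝ ↦ -1 / t ^ 2 - 6 / t ^ 3) (2 / t ^ 3 + 18 / t ^ 4) t := by
    intro t ht
    have h := ((hasDerivAt_const t (-1 : ℝ)).fun_div (hasDerivAt_pow 2 t)
      (pow_ne_zero 2 ht)).fun_sub
      ((hasDerivAt_const t (6 : ℝ)).fun_div (hasDerivAt_pow 3 t) (pow_ne_zero 3 ht))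
    refine h.congr_deriv ?_
    field_simp
    ring
  -- the barrier `gb = 1/θ + 3/θ²`: globally `C²`, equal to `1/t + 3/t²` on `(3/2, ∞)`
  set gb : ℝ → ℝ := fun t ↦ 1 / θ t + 3 / θ t ^ 2
  have hgb : ContDiff ℝ 2 gb :=
    (contDiff_const.div hθ hθne).add
      (contDiff_const.div (hθ.pow 2) fun t ↦ pow_ne_zero 2 (hθne t))
  have hloc : ∀ t₀ : ℝ, 3 / 2 < t₀ → gb =ᶠ[𝓝 t₀] fun t : ℝ ↦ 1 / t + 3 / t ^ 2 := by
    intro t₀ ht₀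
    filter_upwards [eventually_gt_nhds ht₀] with t ht
    show 1 / θ t + 3 / θ t ^ 2 = 1 / t + 3 / t ^ 2
    rw [hθid t ht]
  have hd1 : ∀ t : ℝ, 3 / 2 < t → deriv gb t = -1 / t ^ 2 - 6 / t ^ 3 := by
    intro t ht
    rw [(hloc t ht).deriv_eq]
    exact (hg1 t (show (0 : ℝ) < t by linarith).ne').deriv
  have hd2 : ∀ t : ℝ, 3 / 2 < t → deriv (deriv gb) t = 2 / t ^ 3 + 18 / t ^ 4 := by
    intro t₀ ht₀
    have h : deriv gb =ᶠ[𝓝 t₀] fun t : ℝ ↦ -1 / t ^ 2 - 6 / t ^ 3 := by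
      filter_upwards [eventually_gt_nhds ht₀] with t ht
      exact hd1 t ht
    rw [h.deriv_eq]
    exact (hg2 t₀ (show (0 : ℝ) < t₀ by linarith).ne').deriv
  refine ⟨gb, hgb, fun t ht ↦ ?_, fun t ht ↦ hd1 t (by linarith), fun t ht ↦ hd2 t (by linarith)⟩
  show 1 / θ t + 3 / θ t ^ 2 = 1 / t + 3 / t ^ 2
  rw [hθid t (by linarith)]

open scoped Topology ContDiff in
/-- **A smooth extension of the Munteanu–Wang barrier `1/t + 3/t²`**: the `C^∞` version of
`exists_smooth_barrier` — the same witness `gb = 1/θ + 3/θ²`, with the smooth reparametrisation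
`θ(t) = 1 + (t − 1) · smoothTransition (2(t − 1)) > 0` of the line (`θ(t) = t` for `t ≥ 3/2`), is
`C^∞` with the same values and first two derivatives on `[2, ∞)`; this is the form consumed by the
`C^∞` chart calculus of the minimum principle in step 1 of Munteanu–Wang 2017, Thm. 2.
[folklore] -/
theorem exists_smooth_barrier' : ∃ gb : ℝ → ℝ, ContDiff ℝ ∞ gb ∧
    (∀ t, 2 ≤ t → gb t = 1 / t + 3 / t ^ 2) ∧
    (∀ t, 2 ≤ t → deriv gb t = -1 / t ^ 2 - 6 / t ^ 3) ∧
    (∀ t, 2 ≤ t → deriv (deriv gb) t = 2 / t ^ 3 + 18 / t ^ 4) := by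
  set θ : ℝ → ℝ := fun t ↦ 1 + (t - 1) * Real.smoothTransition (2 * (t - 1))
  have hθ : ContDiff ℝ ∞ θ := contDiff_const.add ((contDiff_id.sub contDiff_const).mul
    (Real.smoothTransition.contDiff.comp (contDiff_const.mul (contDiff_id.sub contDiff_const))))
  have hθ0 : ∀ t, 0 < θ t := fun t ↦ by
    rcases le_total t 1 with h | h
    · simp only [θ, Real.smoothTransition.zero_of_nonpos (by linarith : 2 * (t - 1) ≤ 0),
        mul_zero, add_zero, zero_lt_one]
    · exact add_pos_of_pos_of_nonneg one_pos
        (mul_nonneg (sub_nonneg.2 h) (Real.smoothTransition.nonneg _))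
  have hθid : ∀ t : ℝ, 3 / 2 < t → θ t = t := fun t ht ↦ by
    simp only [θ, Real.smoothTransition.one_of_one_le (by linarith : (1 : ℝ) ≤ 2 * (t - 1))]
    ring
  have hd : ∀ t : ℝ, t ≠ 0 →
      HasDerivAt (fun t : ℝ ↦ 1 / t + 3 / t ^ 2) (-1 / t ^ 2 - 6 / t ^ 3) t ∧
        HasDerivAt (fun t : ℝ ↦ -1 / t ^ 2 - 6 / t ^ 3) (2 / t ^ 3 + 18 / t ^ 4) t := fun t ht ↦
    ⟨(((hasDerivAt_const t (1 : ℝ)).fun_div (hasDerivAt_id' t) ht).fun_add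
        ((hasDerivAt_const t (3 : ℝ)).fun_div (hasDerivAt_pow 2 t) (pow_ne_zero 2 ht))).congr_deriv
        (by field_simp; ring),
      (((hasDerivAt_const t (-1 : ℝ)).fun_div (hasDerivAt_pow 2 t) (pow_ne_zero 2 ht)).fun_sub
        ((hasDerivAt_const t (6 : ℝ)).fun_div (hasDerivAt_pow 3 t) (pow_ne_zero 3 ht))).congr_deriv
        (by field_simp; ring)⟩
  have hd1 : ∀ t : ℝ, 3 / 2 < t →
      deriv (fun t ↦ 1 / θ t + 3 / θ t ^ 2) t = -1 / t ^ 2 - 6 / t ^ 3 := fun t ht ↦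
    (Filter.EventuallyEq.deriv_eq ((eventually_gt_nhds ht).mono fun s hs ↦ by
      simp only [hθid s hs])).trans (hd t (show (0 : ℝ) < t by linarith).ne').1.deriv
  refine ⟨fun t ↦ 1 / θ t + 3 / θ t ^ 2, (contDiff_const.div hθ fun t ↦ (hθ0 t).ne').add
      (contDiff_const.div (hθ.pow 2) fun t ↦ pow_ne_zero 2 (hθ0 t).ne'),
    fun t ht ↦ by simp only [hθid t (by linarith)], fun t ht ↦ hd1 t (by linarith), fun t ht ↦ ?_⟩
  exact (Filter.EventuallyEq.deriv_eq ((eventually_gt_nhds (show (3 : ℝ) / 2 < t by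
    linarith)).mono hd1)).trans (hd t (show (0 : ℝ) < t by linarith).ne').2.deriv

end Literature.Geometry.Riemannian.HamiltonIvey
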